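import Mathlib
import HarnessLib
import Summits.HubbardSuperconductivity.HubbardSuperconductivity.Theorems.KLProgrammeKLRegimeEngineTowerRemeasureSplit

/-!
# Route `KLProgramme` — crux K3 ENGINE (stmt-HubbardSuperconductivity-20437 `KLRegimeEngineV17F2`), stub (b) v2, THE LEVELS PACKAGE (ℓ):
# instantiation (I2), THE JUMP HALF — SPLIT FORM with the overlap constants DISCHARGED (counts kept abstract)
# (E1-LEVELS-BLUEPRINT-g8 §3 (I2); cell gate-hubbard-kl, seat hubbard-kl-k3c2-p3 g10; continuation of `…EngineTowerRemeasureSplit`, p589586)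

`…EngineTowerRemeasureSplit` states the split re-measurement jump (off / on a class `B` of coarse label tuples — the kit's `b` / `b₂` rows) at abstract per-pair
overlap sums AND abstract counts.  Here the overlap sums are discharged — levelled track under the binders of `stub_engine_step_norms` by
`TorusFourierL2.overlap_jump_sums_klEng` (no window), weighted track at the flow frame `K_n` on p3's deep window by `TorusFourierL2.overlapWt_jump_sums_klEng_flow_deep`
(every rate `j ≥ J′`, `klScaleWt_le_of_le`) — while the two counts stay as the hypotheses `27^{|E|}·#{…} ≤ A₁` (off `B`) / `≤ A₂` (on `B`), so that p4's
off-class count («KEYED-R1-OFFCLASS», in flight) and the one-determined-leg count (`card_relCount_prescribed_lastLeg_klAniso_le_window`) plug in by arithmetic only: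

* **`klLevNormOf_jump_le_split_klEng m`** — `∃ C_m > 0` (`= (3CJ/2)^{m+1}`): `klLevNormOf … J′ (m+1) T Ωe ≤ C_m·(A₁·N + A₂·N_B)`;
* **`klWtPinnedSumAt_jump_le_split_klEng_flow_deep dd m`** — `klWtPinnedSumAt … J′ j (m+1) T q w ≤ C_m·(A₁·N + A₂·N_B)` at `K = K_n`.
Everything is proved; no definitions; nothing about the model is asserted; nothing asserts superconductivity.
References: BGM 2006 §2.8 (2.82)–(2.84), (2.88)–(2.90), App. A3 Lemma A3.1 [cite: BenfattoGiulianiMastropietro2006].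
-/

noncomputable section

namespace Summit.HubbardSuperconductivity.HubbardSuperconductivity.Theorems.EngineV8

set_option linter.dupNamespace false -- summit = problem name (single-conjunct summit), D-0017

open Classical
open Real Finset Literature.MathematicalPhysics.QuantumLattice Literature.Probability.LatticeModels GrassmannAlgebra
open Literature.Probability.LatticeModels.BattleFederbush
open Literature.MathematicalPhysics.QuantumLattice.FermiRG
open Summit.HubbardSuperconductivity.HubbardSuperconductivity.Theorems.KLRegimeSplit
open Summit.HubbardSuperconductivity.HubbardSuperconductivity.Theorems.KLProgrammeLegKernels
open Summit.HubbardSuperconductivity.HubbardSuperconductivity.Theorems.DispersionFlow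
open Summit.HubbardSuperconductivity.HubbardSuperconductivity.Theorems.KLRegimeWick
open Summit.HubbardSuperconductivity.HubbardSuperconductivity.Theorems.TorusFourierL2

/-! ## The split jumps with the overlap constants DISCHARGED (counts kept abstract) -/

/-- **THE LEVELLED SPLIT JUMP UNDER THE STUB BINDERS, overlap constants discharged** (`overlap_jump_sums_klEng`, no window): `∃ C_m > 0` (absolute,
`= (3CJ/2)^{m+1}`) such that under the binders of `stub_engine_step_norms`, for `k + 1 ≤ J′ ≤ nScales β + 1`, momentum-conserving `T`, any class `B` and abstract
split counts `A₁`/`A₂` (p4's off-class and on-class counts × `27^{|E|}`): `klLevNormOf … J′ (m+1) T Ωe ≤ C_m·(A₁·N + A₂·N_B)`.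
[cite: BenfattoGiulianiMastropietro2006, §2.8 (2.82)-(2.84), (2.88)-(2.90), App. A3] -/
theorem klLevNormOf_jump_le_split_klEng (m : ℕ) :
    ∃ C : ℝ, 0 < C ∧ ∀ (P : SplitConsts) (R : RenConsts) (c : ℝ), P.WF → R.WF2 → 0 < c → c ≤ klEngC₃6 P R →
      ∀ μ ∈ klWindowC, ∀ U : ℝ, 0 < U → U ≤ klEngU₀9 P R c → ∀ β : ℝ, klBetaMin ≤ β → β ≤ Real.exp (c / U ^ 2) →
      ∀ K : TrigPolyC4v, FrameOK R U (nScales β) μ K → ∀ (L M : ℕ) [NeZero L] [NeZero M],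
      klEngL₃ β U ≤ L → klEngM₃ β U L ≤ M → ∀ k J' : ℕ, k + 1 ≤ J' → J' ≤ nScales β + 1 →
      ∀ T : HubbardGrassmann L M,
        (∀ (m' : ℕ) (X : Fin m' → HubbardFieldIdx L M), ∑ i, signedMomentum L (X i).2 (X i).1.1.2 ≠ 0 → kernel ℂ T m' X = 0) →
      ∀ (B : Finset (Fin (m + 1) → SectorLeg (sectorCount k))) (Ωe : Fin (m + 1) → Option (SectorLeg (sectorCount J')))
        (A₁ A₂ N NB : ℝ), 0 ≤ A₁ → 0 ≤ A₂ → 0 ≤ N → 0 ≤ NB →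
        (∀ (E : Finset (Fin (m + 1))) (τ'' : Fin (m + 1) → SectorLeg (sectorCount J')) (σ' : Fin (m + 1) → SectorLeg (sectorCount k)),
          σ' ∉ B → levelCount Ωe ≤ E.card → E.card ≤ levelCount Ωe + 1 →
          (27 : ℝ) ^ E.card * ((((bgmSectorSet L M (klAnisoFamily L M β μ K klE0 J') (m + 1)).filter fun σ'' => (∀ e ∈ E, σ'' e = τ'' e) ∧ ∀ i,
            (∃ q : FreqMomentum L M, klAnisoFamily L M β μ K klE0 J' (σ'' i).1.1 q ≠ 0 ∧
              bgmFatMultiplier L M klE0 β (nambuXiCT L μ K) k (σ' i).1.1 q ≠ 0) ∧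
            (σ' i).1.2 = (σ'' i).1.2 ∧ (σ' i).2 = (σ'' i).2).card : ℝ)) ≤ A₁) →
        (∀ (E : Finset (Fin (m + 1))) (τ'' : Fin (m + 1) → SectorLeg (sectorCount J')) (σ' : Fin (m + 1) → SectorLeg (sectorCount k)),
          σ' ∈ B → levelCount Ωe ≤ E.card → E.card ≤ levelCount Ωe + 1 →
          (27 : ℝ) ^ E.card * ((((bgmSectorSet L M (klAnisoFamily L M β μ K klE0 J') (m + 1)).filter fun σ'' => (∀ e ∈ E, σ'' e = τ'' e) ∧ ∀ i,
            (∃ q : FreqMomentum L M, klAnisoFamily L M β μ K klE0 J' (σ'' i).1.1 q ≠ 0 ∧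
              bgmFatMultiplier L M klE0 β (nambuXiCT L μ K) k (σ' i).1.1 q ≠ 0) ∧
            (σ' i).1.2 = (σ'' i).1.2 ∧ (σ' i).2 = (σ'' i).2).card : ℝ)) ≤ A₂) →
        (∀ Ωe' : Fin (m + 1) → Option (SectorLeg (sectorCount k)), levelCount Ωe' = levelCount Ωe →
          klLevNormOf L M β μ K k (m + 1) T Ωe' ≤ N) →
        (∀ Ωe' : Fin (m + 1) → Option (SectorLeg (sectorCount k)), levelCount Ωe' = levelCount Ωe →
          hubbardSectorKernelNorm L M β (klAnisoFamily L M β μ K klE0 k) (prescribedTuples B Ωe') T ≤ NB) →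
        klLevNormOf L M β μ K J' (m + 1) T Ωe ≤ C * (A₁ * N + A₂ * NB) := by
  obtain ⟨CJ, hCJ, hov⟩ := overlap_jump_sums_klEng
  refine ⟨(3 * CJ / 2) ^ (m + 1), by positivity, ?_⟩
  intro P R c hP hR2 hc hc6 μ hμ U hU hU9 β hβmin hβc K hK L M _ _ hL3 hM3 k J' hJ hJN T hT B Ωe A₁ A₂ N NB hA₁ hA₂ hN0 hNB0 hRoff hRon hN hNB
  have hβ : 0 < β := KLRegimeSplit.pos_of_klBetaMin_le hβmin
  obtain ⟨_, hcol₁, hrow₁⟩ := hov P R c hP hR2 hc hc6 μ hμ U hU hU9 β hβmin hβc K hK L M hL3 hM3 k J' hJ hJN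
  have hc₁0 : (0 : ℝ) ≤ 3 * CJ * M / β := by positivity
  have h := klLevNormOf_jump_le_split_of_consts hβ μ K hJ T hT hc₁0 hc₁0 hcol₁ hrow₁ m B Ωe hA₁ hA₂ hN0 hNB0 hRoff hRon hN hNB
  have hMne : (M : ℝ) ≠ 0 := by exact_mod_cast NeZero.ne M
  have hεc : imagTimeWeight β M * (3 * CJ * M / β) = 3 * CJ / 2 := by
    unfold imagTimeWeight; field_simp
  have hconst : (3 * CJ * M / β) ^ m * (3 * CJ * M / β) * imagTimeWeight β M ^ (m + 1) = (3 * CJ / 2) ^ (m + 1) := by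
    rw [← pow_succ, ← mul_pow, mul_comm (3 * CJ * M / β), hεc]
  calc klLevNormOf L M β μ K J' (m + 1) T Ωe
      ≤ (3 * CJ * M / β) ^ m * (3 * CJ * M / β) * imagTimeWeight β M ^ (m + 1) * (A₁ * N + A₂ * NB) := h
    _ = (3 * CJ / 2) ^ (m + 1) * (A₁ * N + A₂ * NB) := by rw [hconst]

/-- **THE WEIGHTED SPLIT JUMP AT THE FLOW FRAME ON THE DEEP WINDOW, overlap constants discharged** (p3's `overlapWt_jump_sums_klEng_flow_deep dd`, binder list
verbatim; every rate `j ≥ J′`; counts kept abstract): `klWtPinnedSumAt … J′ j (m+1) T q w ≤ C_m·(A₁·N + A₂·N_B)` at `K = K_n`.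
[cite: BenfattoGiulianiMastropietro2006, §2.8 (2.82)-(2.84), (2.88)-(2.90), App. A3] -/
theorem klWtPinnedSumAt_jump_le_split_klEng_flow_deep (dd m : ℕ) :
    ∃ C : ℝ, 0 < C ∧
      ∀ (G : GeoConsts) (P : SplitConsts) (R : RenConsts) (Q : EngConsts) (cc : ℝ), R.WF2 → 0 < cc → cc ≤ klEngC₃6 P R →
      ∀ μ ∈ klWindowC, ∀ U : ℝ, 0 < U → U ≤ min (klEngU₀3 P R cc) (1 / (R.Gfr 3 + 1)) →
      ∀ β : ℝ, klBetaMin ≤ β → β ≤ Real.exp (cc / U ^ 2) →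
      ∀ (L M : ℕ) [NeZero L] [NeZero M], klEngL₃ β U ≤ L → klEngM₃ β U L ≤ M →
      ∀ n : ℕ, 1 ≤ n → n ≤ nScales β + 1 →
        HistP klPredsV17F2 L M G P Q R β U μ 0 n → FrameOK R U (nScales β) μ (klFlowFrameU L M β U μ n) →
        ∀ k J' : ℕ, k + 1 ≤ J' → J' ≤ n → (4 : ℝ) ^ n * U ≤ (4 : ℝ) ^ (2 * (k + 1) + dd) →
        ∀ T : HubbardGrassmann L M,
          (∀ (m' : ℕ) (X : Fin m' → HubbardFieldIdx L M), ∑ i, signedMomentum L (X i).2 (X i).1.1.2 ≠ 0 → kernel ℂ T m' X = 0) →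
        ∀ j : ℕ, J' ≤ j → ∀ (B : Finset (Fin (m + 1) → SectorLeg (sectorCount k))) (q : Fin (m + 1))
          (w : SpaceTimeIdx L M × SectorLeg (sectorCount J')) (A₁ A₂ N NB : ℝ), 0 ≤ A₁ → 0 ≤ A₂ → 0 ≤ N → 0 ≤ NB →
          (∀ (ℓ'' : SectorLeg (sectorCount J')) (σ' : Fin (m + 1) → SectorLeg (sectorCount k)), σ' ∉ B →
            (27 : ℝ) * ((((bgmSectorSet L M (klAnisoFamily L M β μ (klFlowFrameU L M β U μ n) klE0 J') (m + 1)).filter fun σ'' =>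
              (∀ e ∈ ({q} : Finset (Fin (m + 1))), σ'' e = (fun _ : Fin (m + 1) => ℓ'') e) ∧ ∀ i,
              (∃ q' : FreqMomentum L M, klAnisoFamily L M β μ (klFlowFrameU L M β U μ n) klE0 J' (σ'' i).1.1 q' ≠ 0 ∧
                bgmFatMultiplier L M klE0 β (nambuXiCT L μ (klFlowFrameU L M β U μ n)) k (σ' i).1.1 q' ≠ 0) ∧
              (σ' i).1.2 = (σ'' i).1.2 ∧ (σ' i).2 = (σ'' i).2).card : ℝ)) ≤ A₁) →
          (∀ (ℓ'' : SectorLeg (sectorCount J')) (σ' : Fin (m + 1) → SectorLeg (sectorCount k)), σ' ∈ B →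
            (27 : ℝ) * ((((bgmSectorSet L M (klAnisoFamily L M β μ (klFlowFrameU L M β U μ n) klE0 J') (m + 1)).filter fun σ'' =>
              (∀ e ∈ ({q} : Finset (Fin (m + 1))), σ'' e = (fun _ : Fin (m + 1) => ℓ'') e) ∧ ∀ i,
              (∃ q' : FreqMomentum L M, klAnisoFamily L M β μ (klFlowFrameU L M β U μ n) klE0 J' (σ'' i).1.1 q' ≠ 0 ∧
                bgmFatMultiplier L M klE0 β (nambuXiCT L μ (klFlowFrameU L M β U μ n)) k (σ' i).1.1 q' ≠ 0) ∧
              (σ' i).1.2 = (σ'' i).1.2 ∧ (σ' i).2 = (σ'' i).2).card : ℝ)) ≤ A₂) →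
          (∀ w' : SpaceTimeIdx L M × SectorLeg (sectorCount k),
            klWtPinnedSumAt L M β μ (klFlowFrameU L M β U μ n) k j (m + 1) T q w' ≤ N) →
          (∀ (ℓ' : SectorLeg (sectorCount k)) (y' : SpaceTimeIdx L M),
            imagTimeWeight β M ^ m * ∑ σ' ∈ B.filter (fun σ' : Fin (m + 1) → SectorLeg (sectorCount k) => σ' q = ℓ'),
              ∑ x' ∈ univ.filter (fun x' : Fin (m + 1) → SpaceTimeIdx L M => x' q = y'),
                klScaleWt L M β j ((univ.image x').image (fun x : SpaceTimeIdx L M => (((((2 * (x.1 : ℕ) : ℕ)) : ZMod (2 * (2 * M)))), x.2))) *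
                  ‖sectorisedKernel L M β (klAnisoFamily L M β μ (klFlowFrameU L M β U μ n) klE0 k) T (m + 1) σ' x'‖ ≤ NB) →
          klWtPinnedSumAt L M β μ (klFlowFrameU L M β U μ n) J' j (m + 1) T q w ≤ C * (A₁ * N + A₂ * NB) := by
  obtain ⟨CJ, hCJ, hov⟩ := overlapWt_jump_sums_klEng_flow_deep dd
  refine ⟨(3 * CJ / 2) ^ (m + 1), by positivity, ?_⟩
  intro G P R Q cc hR2 hcc hcc6 μ hμ U hU hUle β hβmin hβc L M _ _ hL3 hM3 n hn1 hnN hhist hfr k J' hJ hJn hwin T hT j hjJ B q w A₁ A₂ N NB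
    hA₁ hA₂ hN0 hNB0 hRoff hRon hN hNB
  have hβ : 0 < β := KLRegimeSplit.pos_of_klBetaMin_le hβmin
  set K : TrigPolyC4v := klFlowFrameU L M β U μ n with hK
  obtain ⟨_, hcolJ, hrowJ⟩ := hov G P R Q cc hR2 hcc hcc6 μ hμ U hU hUle β hβmin hβc L M hL3 hM3 n hn1 hnN hhist hfr k J' hJ hJn hwin
  have hc₁0 : (0 : ℝ) ≤ 3 * CJ * M / β := by positivity
  have hcol₁ : ∀ (ω'' : Fin (sectorCount J')) (ω' : Fin (sectorCount k)) (σ c : Fin 2) (x' : SpaceTimeIdx L M),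
      ∑ x'' : SpaceTimeIdx L M, ‖(sectorAnalysisMatrix L M β (klAnisoFamily L M β μ K klE0 J') *
        sectorSubMatrix L M β (bgmFatMultiplier L M klE0 β (nambuXiCT L μ K) k)) (x'', ((ω'', σ), c)) (x', ((ω', σ), c))‖ *
          klScaleWt L M β j
            {latticeLegPos (2 * (2 * M)) ((x'', ((ω'', σ), c)) : SpaceTimeIdx L M × SectorLeg (sectorCount J')),
              latticeLegPos (2 * (2 * M)) ((x', ((ω', σ), c)) : SpaceTimeIdx L M × SectorLeg (sectorCount k))} ≤ 3 * CJ * M / β := by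
    intro ω'' ω' σ c x'
    refine le_trans (sum_le_sum fun x'' _ => mul_le_mul_of_nonneg_left (klScaleWt_le_of_le β hjJ _) (norm_nonneg _)) ?_
    exact hcolJ ω'' ω' σ c x'
  have hrow₁ : ∀ (ω'' : Fin (sectorCount J')) (ω' : Fin (sectorCount k)) (σ c : Fin 2) (x'' : SpaceTimeIdx L M),
      ∑ x' : SpaceTimeIdx L M, ‖(sectorAnalysisMatrix L M β (klAnisoFamily L M β μ K klE0 J') *
        sectorSubMatrix L M β (bgmFatMultiplier L M klE0 β (nambuXiCT L μ K) k)) (x'', ((ω'', σ), c)) (x', ((ω', σ), c))‖ *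
          klScaleWt L M β j
            {latticeLegPos (2 * (2 * M)) ((x'', ((ω'', σ), c)) : SpaceTimeIdx L M × SectorLeg (sectorCount J')),
              latticeLegPos (2 * (2 * M)) ((x', ((ω', σ), c)) : SpaceTimeIdx L M × SectorLeg (sectorCount k))} ≤ 3 * CJ * M / β := by
    intro ω'' ω' σ c x''
    refine le_trans (sum_le_sum fun x' _ => mul_le_mul_of_nonneg_left (klScaleWt_le_of_le β hjJ _) (norm_nonneg _)) ?_
    exact hrowJ ω'' ω' σ c x''
  have h := klWtPinnedSumAt_jump_le_split_of_consts hβ μ K hJ T hT j hc₁0 hc₁0 hcol₁ hrow₁ m B q w hA₁ hA₂ hN0 hNB0 hRoff hRon hN hNB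
  have hMne : (M : ℝ) ≠ 0 := by exact_mod_cast NeZero.ne M
  have hεc : imagTimeWeight β M * (3 * CJ * M / β) = 3 * CJ / 2 := by
    unfold imagTimeWeight; field_simp
  have hconst : (3 * CJ * M / β) ^ m * (3 * CJ * M / β) * imagTimeWeight β M ^ (m + 1) = (3 * CJ / 2) ^ (m + 1) := by
    rw [← pow_succ, ← mul_pow, mul_comm (3 * CJ * M / β), hεc]
  calc klWtPinnedSumAt L M β μ K J' j (m + 1) T q w
      ≤ (3 * CJ * M / β) ^ m * (3 * CJ * M / β) * imagTimeWeight β M ^ (m + 1) * (A₁ * N + A₂ * NB) := h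
    _ = (3 * CJ / 2) ^ (m + 1) * (A₁ * N + A₂ * NB) := by rw [hconst]

end Summit.HubbardSuperconductivity.HubbardSuperconductivity.Theorems.EngineV8

end
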